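import Mathlib.MeasureTheory.Measure.Portmanteau
import Literature.Probability.Percolation.QuadCrossingContinuityEvents
import Literature.Probability.Percolation.QuadCrossingSpaceProofs
import Literature.Probability.Percolation.QuadCrossingSpaceZ2
import HarnessLib

/-!
# Schramm–Smirnov's Lemma 5.1 from the continuity estimate (5.1): the §5 argument, proved

Topic `Probability/Percolation`; sibling proofs file of `QuadCrossingContinuityEvents.lean`, whose
one named fact `SchrammSmirnov2011_lemma_5_1` (O. Schramm, S. Smirnov, *On the scaling limits of
planar percolation*, Ann. Probab. 39 (2011), arXiv:1101.5820, Lemma 5.1: "`μ₀(∂⊞_{Q₀}) = 0` for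
every subsequential scaling limit `μ₀` and every `Q₀ ∈ 𝒬_D`") it reduces to its single
percolation input.

**The printed proof (§5, p. 21 of the arXiv version) has two halves.**

1. *Percolation input* (from the RSW continuity Lemma 6.1, "lcont", via the extension `Q̂₀` of
   `Q₀` and the perturbations `Q^q`): for every `ε > 0` there are quads `Q' < Q₀ < Q''` in `D`
   with
   `limsup_{|η| → 0} μ_η(⊞_{Q'} Δ ⊞_{Q''}) < 4ε`.                                        — (5.1)
2. *Topology of `(ℋ_D, 𝒯_D)` and the portmanteau theorem*: with `U' = {Q : Q₀ < Q < Q''}` one has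
   `⊞_{Q''} ⊆ V_{U'} ⊆ ⊞_{Q₀}`, hence `closure V^{Q₀} ⊆ (V_{U'})ᶜ ⊆ V^{Q''}` and
   `∂⊞_{Q₀} = ∂V^{Q₀} ⊆ V^{Q''}`; with `U = {Q : Q' < Q < Q''}`, `∂⊞_{Q₀} ⊆ ⊞_{Q₀} ⊆ V_U`; and
   `V_U ⊆ ⊞_{Q'}`, `V^{Q''} = ¬⊞_{Q''}`.  The open set `V_U ∩ V^{Q''}` contains `∂⊞_{Q₀}`, so by the
   portmanteau theorem (Dudley, Thm. 11.1.1)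
   `μ₀(∂⊞_{Q₀}) ≤ μ₀(V_U ∩ V^{Q''}) ≤ liminf μ_η(V_U ∩ V^{Q''}) ≤ limsup μ_η(⊞_{Q'} ∖ ⊞_{Q''}) < 4ε`.

**This file proves half 2 completely and states half 1 as an explicit hypothesis** (no new named
fact is introduced; D-0026):

* `finiteMeasure_le_liminf_measure_open_of_tendsto` — the open-set half of the portmanteau
  theorem for weakly convergent FINITE measures (Mathlib has it for probability measures,
  `ProbabilityMeasure.le_liminf_measure_open_of_tendsto`, and the closed-set half for finite
  measures; we approximate `𝟙_G` from below by `1 - fₙ`, `fₙ ↓ 𝟙_{Gᶜ}` from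
  `HasOuterApproxClosed`).  `(ℋ_D, 𝒯_D)` is metrizable by Theorem 1.4 (1)
  (`SchrammSmirnov2011_thm_1_4_holds`), whence `HasOuterApproxClosed`.
* `Quad.exists_strictlyDominated_between` — `Q₁ < Q₂ ⟹ ∃ Q, Q₁ < Q < Q₂` (from `(esb)`,
  `Quad.mem_closure_setOf_strictlyDominated`, and openness of `{Q : Q₁ < Q}`); the two inclusion
  chains above: `QuadConfig.closure_notCrossed_subset`, `QuadConfig.frontier_crossedEvent_subset`,
  `QuadConfig.someCrossed_inter_notCrossed_subset`.
* `measure_frontier_crossedEvent_eq_zero_of_frequently` — for ANY weakly convergent family of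
  finite measures on `ℋ_D`: (5.1) (it suffices frequently along the family) implies
  `μ(∂⊞_{Q₀}) = 0`.
* `measure_frontier_crossedEvent_eq_zero_of_subseqLimit`, `SchrammSmirnov2011_lemma_5_1_of_continuity`
  — the same for the tree's subsequential limits of critical bond percolation on `δℤ²`, with (5.1)
  in its discrete form: `P_{1/2}[Q' is crossed inside the open edges of δℤ² but Q'' is not] ≤ ε`
  for all small `δ` (the laws are push-forwards, possibly by a non-measurable map — then they
  vanish; `Q' ∈ S_ω = closure(raw crossed quads)` only gives that every `Q < Q'` is raw-crossed,
  `exists_isCrossing_of_mem_closure`, so an intermediate quad is inserted).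

What remains for `SchrammSmirnov2011_lemma_5_1_holds` is exactly the hypothesis of
`SchrammSmirnov2011_lemma_5_1_of_continuity`, i.e. Schramm–Smirnov's Lemma 6.1 (RSW, lowest
crossing, duality) for bond percolation on `ℤ²` and the perturbations `Q^{q_{∓s}}` of a general
quad; it is not restated as a fact here.

## References

* O. Schramm, S. Smirnov, Ann. Probab. 39 (2011) 1768–1814, arXiv:1101.5820: §5, Lemma 5.1 and
  its proof, eq. (5.1); §6, Lemma 6.1. [SchrammSmirnov2011]
* R. M. Dudley, *Real Analysis and Probability*, Thm. 11.1.1 (portmanteau), as cited there.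
-/

noncomputable section

open Set Filter MeasureTheory
open scoped Topology ENNReal NNReal unitInterval

namespace Literature.Probability.Percolation

namespace QuadCrossing

/-! ### Portmanteau for finite measures: the open-set inequality -/

section Portmanteau

variable {Ω ι : Type*} [MeasurableSpace Ω] [TopologicalSpace Ω] [HasOuterApproxClosed Ω]
  [OpensMeasurableSpace Ω]

/-- **Portmanteau, open sets, finite measures.** If finite Borel measures `μs i` converge weakly
to `μ` on a space where indicators of closed sets are decreasing limits of bounded continuous
functions, then `μ G ≤ liminf μs i G` for every open `G`.  (Test the convergence against
`1 - fₙ ≤ 𝟙_G`, where `fₙ ↓ 𝟙_{Gᶜ}`, and let `n → ∞`: `∫ (1 - fₙ) dμ = μ(Ω) - ∫ fₙ dμ → μ G`.)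
[cite: SchrammSmirnov2011, proof of Lemma 5.1 (portmanteau step; Dudley Thm. 11.1.1)] -/
theorem finiteMeasure_le_liminf_measure_open_of_tendsto {L : Filter ι} {μ : FiniteMeasure Ω}
    {μs : ι → FiniteMeasure Ω} (μs_lim : Tendsto μs L (𝓝 μ)) {G : Set Ω} (hG : IsOpen G) :
    (μ : Measure Ω) G ≤ L.liminf fun i => (μs i : Measure Ω) G := by
  rcases L.eq_or_neBot with rfl | _
  · simp only [liminf_bot, le_top]
  have hF : IsClosed Gᶜ := hG.isClosed_compl
  set fs := hF.apprSeq with hfs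
  -- `1 - fs n ≤ 𝟙_G`
  have hpt : ∀ n ω, (((1 - fs n) ω : ℝ≥0) : ℝ≥0∞) ≤ G.indicator 1 ω := by
    intro n ω
    rw [BoundedContinuousFunction.sub_apply, BoundedContinuousFunction.coe_one, Pi.one_apply]
    by_cases hω : ω ∈ G
    · rw [indicator_of_mem hω, Pi.one_apply, ← ENNReal.coe_one]
      exact ENNReal.coe_le_coe.mpr tsub_le_self
    · rw [HasOuterApproxClosed.apprSeq_apply_eq_one hF n (mem_compl hω), tsub_self,
        ENNReal.coe_zero]
      exact zero_le
  -- hence `∫ (1 - fs n) dμ = lim_i ∫ (1 - fs n) d(μs i) ≤ liminf_i (μs i) G`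
  have key : ∀ n, ∫⁻ ω, ((1 - fs n) ω : ℝ≥0∞) ∂(μ : Measure Ω) ≤
      L.liminf fun i => (μs i : Measure Ω) G := by
    intro n
    have hlim := (FiniteMeasure.tendsto_iff_forall_lintegral_tendsto.mp μs_lim) (1 - fs n)
    rw [← hlim.liminf_eq]
    refine liminf_le_liminf (Eventually.of_forall fun i => ?_)
    calc ∫⁻ ω, ((1 - fs n) ω : ℝ≥0∞) ∂(μs i : Measure Ω)
        ≤ ∫⁻ ω, G.indicator 1 ω ∂(μs i : Measure Ω) := lintegral_mono (hpt n)
      _ = (μs i : Measure Ω) G := lintegral_indicator_one hG.measurableSet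
  -- and `∫ (1 - fs n) dμ = μ univ - ∫ fs n dμ → μ univ - μ Gᶜ = μ G`
  have hsub : ∀ n, ∫⁻ ω, ((1 - fs n) ω : ℝ≥0∞) ∂(μ : Measure Ω) =
      (μ : Measure Ω) univ - ∫⁻ ω, (fs n ω : ℝ≥0∞) ∂(μ : Measure Ω) := by
    intro n
    have h1 : (fun ω => (((1 - fs n) ω : ℝ≥0) : ℝ≥0∞)) = fun ω => (1 : ℝ≥0∞) - fs n ω := by
      funext ω
      rw [BoundedContinuousFunction.sub_apply, ENNReal.coe_sub, BoundedContinuousFunction.coe_one,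
        Pi.one_apply, ENNReal.coe_one]
    have hle : (fun ω => ((fs n ω : ℝ≥0) : ℝ≥0∞)) ≤ᵐ[(μ : Measure Ω)] fun _ => (1 : ℝ≥0∞) :=
      Eventually.of_forall fun ω => by
        change ((fs n ω : ℝ≥0) : ℝ≥0∞) ≤ 1
        exact_mod_cast HasOuterApproxClosed.apprSeq_apply_le_one hF n ω
    rw [h1, lintegral_sub (fs n).continuous.measurable.coe_nnreal_ennreal
      ((fs n).lintegral_lt_top_of_nnreal _).ne hle, lintegral_one]
  have hGeq : (μ : Measure Ω) univ - (μ : Measure Ω) Gᶜ = (μ : Measure Ω) G := by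
    rw [measure_compl hG.measurableSet (measure_ne_top _ _),
      ENNReal.sub_sub_cancel (measure_ne_top _ _) (measure_mono (subset_univ _))]
  have hT : Tendsto (fun n => ∫⁻ ω, ((1 - fs n) ω : ℝ≥0∞) ∂(μ : Measure Ω)) atTop
      (𝓝 ((μ : Measure Ω) G)) := by
    simp only [hsub]
    rw [← hGeq]
    exact ENNReal.Tendsto.sub tendsto_const_nhds
      (HasOuterApproxClosed.tendsto_lintegral_apprSeq hF (μ : Measure Ω))
      (Or.inl (measure_ne_top _ _))
  exact le_of_tendsto' hT key

end Portmanteau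

variable {D : Set ℂ}

/-! ### Between two strictly comparable quads there is a third -/

/-- If `Q₁ < Q₂` in `𝒬_D` (`D` open) then `Q₁ < Q < Q₂` for some quad `Q`: by `(esb)`
(`Quad.mem_closure_setOf_strictlyDominated`) `Q₂` is a limit of quads `Q < Q₂`, and
`{Q : Q₁ < Q}` is an open neighbourhood of `Q₂`.  (Used twice in the proof of Lemma 5.1: for
`⊞_{Q''} ⊆ V_{U'}` and for `⊞_{Q₀} ⊆ V_U`.) [cite: SchrammSmirnov2011, §3 (3.2) and proof of Lemma 5.1] -/
theorem Quad.exists_strictlyDominated_between (hD : IsOpen D) {Q₁ Q₂ : Quad D}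
    (h : Quad.StrictlyDominated Q₁ Q₂) :
    ∃ Q : Quad D, Quad.StrictlyDominated Q₁ Q ∧ Quad.StrictlyDominated Q Q₂ := by
  obtain ⟨Q, hQ₁, hQ₂⟩ := mem_closure_iff.mp (Quad.mem_closure_setOf_strictlyDominated hD Q₂)
    {Q | Quad.StrictlyDominated Q₁ Q} (Quad.isOpen_setOf_strictlyDominated_right Q₁) h
  exact ⟨Q, hQ₁, hQ₂⟩

/-! ### The two inclusion chains of the proof of Lemma 5.1 -/

namespace QuadConfig

/-- **`closure V^{Q₀} ⊆ V^{Q''}` for `Q₀ < Q''`.**  With `U' = {Q : Q₀ < Q < Q''}`: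
`V^{Q₀} ⊆ (V_{U'})ᶜ` (a lower set meeting `U'` contains `Q₀`), `(V_{U'})ᶜ` is closed, and
`(V_{U'})ᶜ ⊆ V^{Q''}` (a lower set containing `Q''` contains a quad strictly between `Q₀` and
`Q''`, which lies in `U'`). [cite: SchrammSmirnov2011, proof of Lemma 5.1] -/
theorem closure_notCrossed_subset (hD : IsOpen D) {Q₀ Q'' : Quad D}
    (h : Quad.StrictlyDominated Q₀ Q'') : closure (notCrossed Q₀) ⊆ notCrossed Q'' := by
  set U' : Set (Quad D) := {Q | Quad.StrictlyDominated Q₀ Q ∧ Quad.StrictlyDominated Q Q''}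
    with hU'def
  have hU' : IsOpen U' :=
    (Quad.isOpen_setOf_strictlyDominated_right Q₀).inter
      (Quad.isOpen_setOf_strictlyDominated_left Q'')
  have h1 : notCrossed Q₀ ⊆ (someCrossed U')ᶜ := by
    rintro S hS ⟨Q, hQS, hQ₀Q, -⟩
    exact hS (S.isLowerQuadSet hQS hQ₀Q)
  have h2 : (someCrossed U')ᶜ ⊆ notCrossed Q'' := by
    intro S hS hQ''S
    obtain ⟨Q, hQ₀Q, hQQ''⟩ := Quad.exists_strictlyDominated_between hD h
    exact hS ⟨Q, S.isLowerQuadSet hQ''S hQQ'', hQ₀Q, hQQ''⟩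
  exact (closure_minimal h1 (isOpen_someCrossed hU').isClosed_compl).trans h2

/-- **`∂⊞_{Q₀} ⊆ V_U ∩ V^{Q''}`** for `Q' < Q₀ < Q''`, `U = {Q : Q' < Q < Q''}` (Schramm–Smirnov,
proof of Lemma 5.1): `∂⊞_{Q₀} ⊆ ⊞_{Q₀} ⊆ V_U` (a lower set containing `Q₀` contains a quad of
`U`, by `(esb)` at `Q₀` inside the open neighbourhood `{Q' < ·} ∩ {· < Q''}` of `Q₀`), and
`∂⊞_{Q₀} = ∂V^{Q₀} ⊆ closure V^{Q₀} ⊆ V^{Q''}` (`closure_notCrossed_subset`).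
[cite: SchrammSmirnov2011, proof of Lemma 5.1] -/
theorem frontier_crossedEvent_subset (hD : IsOpen D) {Q' Q₀ Q'' : Quad D}
    (h' : Quad.StrictlyDominated Q' Q₀) (h'' : Quad.StrictlyDominated Q₀ Q'') :
    frontier (crossedEvent Q₀) ⊆
      someCrossed {Q | Quad.StrictlyDominated Q' Q ∧ Quad.StrictlyDominated Q Q''} ∩
        notCrossed Q'' := by
  refine subset_inter ?_ ?_
  · refine (isClosed_crossedEvent Q₀).frontier_subset.trans fun S hS => ?_
    obtain ⟨Q, ⟨hQ'Q, hQQ''⟩, hQQ₀⟩ := mem_closure_iff.mp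
      (Quad.mem_closure_setOf_strictlyDominated hD Q₀) _
      ((Quad.isOpen_setOf_strictlyDominated_right Q').inter
        (Quad.isOpen_setOf_strictlyDominated_left Q'')) ⟨h', h''⟩
    exact ⟨Q, S.isLowerQuadSet hS hQQ₀, hQ'Q, hQQ''⟩
  · rw [← frontier_compl, compl_crossedEvent]
    exact frontier_subset_closure.trans (closure_notCrossed_subset hD h'')

/-- `V_U ∩ V^{Q''} ⊆ ⊞_{Q'} ∖ ⊞_{Q''}` for `U = {Q : Q' < Q < Q''}` ("observe that `V_U ⊂ ⊞_{Q'}`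
while `V^{Q''} = ¬⊞_{Q''}`": a lower set meeting `U` contains `Q'`).
[cite: SchrammSmirnov2011, proof of Lemma 5.1] -/
theorem someCrossed_inter_notCrossed_subset {Q' Q'' : Quad D} :
    someCrossed {Q | Quad.StrictlyDominated Q' Q ∧ Quad.StrictlyDominated Q Q''} ∩
        notCrossed Q'' ⊆ crossedEvent Q' \ crossedEvent Q'' := by
  rintro S ⟨⟨Q, hQS, hQ'Q, -⟩, hQ''⟩
  exact ⟨S.isLowerQuadSet hQS hQ'Q, hQ''⟩

/-- `V_U ∩ V^{Q''}` is open in `𝒯_D` (`U = {Q : Q' < Q < Q''}` is open by `(eopen)`).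
[cite: SchrammSmirnov2011, proof of Lemma 5.1] -/
theorem isOpen_someCrossed_inter_notCrossed (Q' Q'' : Quad D) :
    IsOpen (someCrossed {Q | Quad.StrictlyDominated Q' Q ∧ Quad.StrictlyDominated Q Q''} ∩
      notCrossed Q'') :=
  (isOpen_someCrossed ((Quad.isOpen_setOf_strictlyDominated_right Q').inter
    (Quad.isOpen_setOf_strictlyDominated_left Q''))).inter (isOpen_notCrossed Q'')

/-- `(ℋ_D, 𝒯_D)` admits outer approximation of closed sets by bounded continuous functions
(it is metrizable: Schramm–Smirnov, Thm. 1.4 (1), `SchrammSmirnov2011_thm_1_4_holds`), so the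
portmanteau theorem applies to it. [cite: SchrammSmirnov2011, Thm. 1.4 (1)] -/
theorem hasOuterApproxClosed (hD : IsOpen D) (hne : D.Nonempty) :
    HasOuterApproxClosed (QuadConfig D) := by
  haveI : TopologicalSpace.MetrizableSpace (QuadConfig D) :=
    (SchrammSmirnov2011_thm_1_4_holds D hD hne).1.2.1
  infer_instance

end QuadConfig

/-! ### Lemma 5.1 from (5.1): general weak limits -/

/-- **Schramm–Smirnov's Lemma 5.1 from their estimate (5.1), for any weak limit.**  Let `D ⊆ ℂ`
be open and nonempty, let finite Borel measures `μs i` on `(ℋ_D, 𝒯_D)` converge weakly to `μ`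
along a filter `L`, and let `Q₀ ∈ 𝒬_D`.  If for every `ε > 0` there are quads `Q' < Q₀ < Q''`
with `μs i (⊞_{Q'} ∖ ⊞_{Q''}) ≤ ε` frequently along `L` (in the source: (5.1),
`limsup_η μ_η(⊞_{Q'} Δ ⊞_{Q''}) < 4ε`, from Lemma 6.1), then the crossing event `⊞_{Q₀}` is a
`μ`-continuity set: `μ(∂⊞_{Q₀}) = 0`.  Proof as printed: `∂⊞_{Q₀} ⊆ V_U ∩ V^{Q''}` (open),
portmanteau, `V_U ∩ V^{Q''} ⊆ ⊞_{Q'} ∖ ⊞_{Q''}`. [cite: SchrammSmirnov2011, Lemma 5.1 (proof, §5)] -/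
theorem measure_frontier_crossedEvent_eq_zero_of_frequently (hD : IsOpen D) (hne : D.Nonempty)
    {ι : Type*} {L : Filter ι} {μs : ι → FiniteMeasure (QuadConfig D)}
    {μ : FiniteMeasure (QuadConfig D)} (hlim : Tendsto μs L (𝓝 μ)) (Q₀ : Quad D)
    (h : ∀ ε : ℝ≥0∞, 0 < ε → ∃ Q' Q'' : Quad D, Quad.StrictlyDominated Q' Q₀ ∧
      Quad.StrictlyDominated Q₀ Q'' ∧
      ∃ᶠ i in L, (μs i : Measure (QuadConfig D))
        (QuadConfig.crossedEvent Q' \ QuadConfig.crossedEvent Q'') ≤ ε) :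
    (μ : Measure (QuadConfig D)) (frontier (QuadConfig.crossedEvent Q₀)) = 0 := by
  haveI := QuadConfig.hasOuterApproxClosed hD hne
  refine le_antisymm (le_of_forall_gt_imp_ge_of_dense fun ε hε => ?_) zero_le
  obtain ⟨Q', Q'', h', h'', hfreq⟩ := h ε hε
  calc (μ : Measure (QuadConfig D)) (frontier (QuadConfig.crossedEvent Q₀))
      ≤ (μ : Measure (QuadConfig D))
          (QuadConfig.someCrossed
              {Q | Quad.StrictlyDominated Q' Q ∧ Quad.StrictlyDominated Q Q''} ∩
            QuadConfig.notCrossed Q'') :=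
        measure_mono (QuadConfig.frontier_crossedEvent_subset hD h' h'')
    _ ≤ L.liminf fun i => (μs i : Measure (QuadConfig D))
          (QuadConfig.someCrossed
              {Q | Quad.StrictlyDominated Q' Q ∧ Quad.StrictlyDominated Q Q''} ∩
            QuadConfig.notCrossed Q'') :=
        finiteMeasure_le_liminf_measure_open_of_tendsto hlim
          (QuadConfig.isOpen_someCrossed_inter_notCrossed Q' Q'')
    _ ≤ ε := liminf_le_of_frequently_le' (hfreq.mono fun i hi =>
        (measure_mono QuadConfig.someCrossed_inter_notCrossed_subset).trans hi)

/-! ### Lemma 5.1 from (5.1): subsequential scaling limits of bond percolation on `δℤ²` -/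

open Literature.Probability.LatticeModels

/-- If `Q' < Q₁` and `Q₁` is a limit of quads having a crossing inside a set `O`, then `Q'` has a
crossing inside `O` (the crossed quads form a `≤`-lower set, and `Q' ≤ Q` for all `Q` near `Q₁`).
In particular `Q₁ ∈ S_ω` forces `Q'` to be crossed by the drawn open edges of `ω`.
[cite: SchrammSmirnov2011, §1.3 ("crossing of a quad automatically contains crossings of 'shorter' sub-quads")] -/
theorem Quad.exists_isCrossing_of_mem_closure {O : Set ℂ} {Q' Q₁ : Quad D}
    (h : Quad.StrictlyDominated Q' Q₁)
    (hmem : Q₁ ∈ closure {Q : Quad D | ∃ K, Q.IsCrossing K ∧ K ⊆ O}) :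
    ∃ K, Q'.IsCrossing K ∧ K ⊆ O := by
  obtain ⟨U₁, U₂, -, hU₂, h₁, h₂, hdom⟩ := Quad.strictlyDominated_iff.mp h
  obtain ⟨Q, hQU, K, hK, hKO⟩ := mem_closure_iff.mp hmem U₂ hU₂ h₂
  obtain ⟨K', hK'K, hK'⟩ := hdom Q' h₁ Q hQU K hK
  exact ⟨K', hK', hK'K.trans hKO⟩

/-- The law `μ_δ` of `S_ω` charges `⊞_{Q₁} ∖ ⊞_{Q''}` at most by the `P_{1/2}`-probability that
`Q'` is crossed inside the drawn open edges of `δℤ²` while `Q''` is not, for any `Q' < Q₁`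
(`μ_δ` is the push-forward of `P_{1/2}` under `ω ↦ S_ω = closure (raw crossed quads)`, or `0` if
that map is not a.e.-measurable; `Q₁ ∈ S_ω` gives a raw crossing of `Q'` by
`Quad.exists_isCrossing_of_mem_closure`, and `Q'' ∉ S_ω` forbids a raw crossing of `Q''`).
[cite: SchrammSmirnov2011, §1.3 and proof of Lemma 5.1] -/
theorem z2QuadLaw_crossedEvent_diff_le {Q' Q₁ Q'' : Quad D} (h : Quad.StrictlyDominated Q' Q₁)
    (δ : ℝ) :
    (z2QuadLaw D δ : Measure (QuadConfig D))
        (QuadConfig.crossedEvent Q₁ \ QuadConfig.crossedEvent Q'') ≤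
      bondPercolation (zdGraph 2) half
        {ω | (∃ K, Q'.IsCrossing K ∧ K ⊆ openEdgeUnion δ ω) ∧
          ¬ ∃ K, Q''.IsCrossing K ∧ K ⊆ openEdgeUnion δ ω} := by
  rw [toMeasure_z2QuadLaw]
  by_cases hf : AEMeasurable (z2QuadConfig D δ) (bondPercolation (zdGraph 2) half)
  · rw [Measure.map_apply_of_aemeasurable hf
      ((QuadConfig.isClosed_crossedEvent Q₁).measurableSet.diff
        (QuadConfig.isClosed_crossedEvent Q'').measurableSet)]
    refine measure_mono ?_
    rintro ω ⟨hQ₁, hQ''⟩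
    have hQ₁' : Q₁ ∈ (z2QuadConfig D δ ω : Set (Quad D)) := hQ₁
    have hQ''' : Q'' ∉ (z2QuadConfig D δ ω : Set (Quad D)) := hQ''
    rw [coe_z2QuadConfig] at hQ₁' hQ'''
    exact ⟨Quad.exists_isCrossing_of_mem_closure h hQ₁', fun hK => hQ''' (subset_closure hK)⟩
  · rw [Measure.map_of_not_aemeasurable hf]
    exact zero_le

/-- **Lemma 5.1 from (5.1), for the subsequential scaling limits of critical bond percolation on
`δℤ²`** (`IsSubseqQuadLimit`).  Hypothesis = the discrete content of Schramm–Smirnov's (5.1) at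
`Q₀`: for every `ε > 0` there are quads `Q' < Q₀ < Q''` of `D` and `δ₀ > 0` such that for all
meshes `0 < δ < δ₀`, with `P_{1/2}`-probability at most `ε` the quad `Q'` has a crossing inside
the drawn open edges `openEdgeUnion δ ω` of `δℤ²` while `Q''` has none (printed:
`limsup_η μ_η(⊞_{Q'} Δ ⊞_{Q''}) < 4ε`, obtained from Lemma 6.1).  Conclusion: `μ(∂⊞_{Q₀}) = 0`.
(The mesh normalisation of `IsSubseqQuadLimit` differs from `z2QuadLaw` by the factor `√2`,
`isSubseqQuadLimit_iff`; an intermediate quad `Q' < Q₁ < Q₀` absorbs the closure in `S_ω`.)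
[cite: SchrammSmirnov2011, Lemma 5.1 (proof, §5)] -/
theorem measure_frontier_crossedEvent_eq_zero_of_subseqLimit (hD : IsOpen D) (hne : D.Nonempty)
    {μ : FiniteMeasure (QuadConfig D)} (hμ : IsSubseqQuadLimit D μ) (Q₀ : Quad D)
    (h : ∀ ε : ℝ≥0∞, 0 < ε → ∃ Q' Q'' : Quad D, Quad.StrictlyDominated Q' Q₀ ∧
      Quad.StrictlyDominated Q₀ Q'' ∧ ∃ δ₀ : ℝ, 0 < δ₀ ∧ ∀ δ : ℝ, 0 < δ → δ < δ₀ →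
        bondPercolation (zdGraph 2) half
          {ω | (∃ K, Q'.IsCrossing K ∧ K ⊆ openEdgeUnion δ ω) ∧
            ¬ ∃ K, Q''.IsCrossing K ∧ K ⊆ openEdgeUnion δ ω} ≤ ε) :
    (μ : Measure (QuadConfig D)) (frontier (QuadConfig.crossedEvent Q₀)) = 0 := by
  obtain ⟨δs, hpos, hδ0, hlim⟩ := (isSubseqQuadLimit_iff D μ).mp hμ
  refine measure_frontier_crossedEvent_eq_zero_of_frequently hD hne hlim Q₀ fun ε hε => ?_
  obtain ⟨Q', Q'', h', h'', δ₀, hδ₀, hP⟩ := h ε hε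
  obtain ⟨Q₁, h'₁, h₁⟩ := Quad.exists_strictlyDominated_between hD h'
  refine ⟨Q₁, Q'', h₁, h'', ?_⟩
  have hev : ∀ᶠ k in atTop, δs k < δ₀ := (tendsto_order.1 hδ0).2 δ₀ hδ₀
  exact (hev.mono fun k hk =>
    (z2QuadLaw_crossedEvent_diff_le h'₁ (δs k)).trans (hP (δs k) (hpos k) hk)).frequently

/-- **Schramm–Smirnov's Lemma 5.1 reduced to their continuity estimate (5.1).**  If for every
open nonempty `D ⊆ ℂ`, every quad `Q₀ ∈ 𝒬_D` and every `ε > 0` there are quads `Q' < Q₀ < Q''`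
of `D` and `δ₀ > 0` with
`P_{1/2}[Q' crossed inside the open edges of δℤ² ∧ Q'' not crossed] ≤ ε` for all `0 < δ < δ₀`
— the discrete form of (5.1), which the source derives from its RSW continuity Lemma 6.1 via the
perturbations `Q' = Q^{q_{-δ₀/2}}`, `Q'' = Q^{q_{δ₀/2}}` of `Q₀` — then the named fact
`SchrammSmirnov2011_lemma_5_1` holds.  This is the whole of §5 of the printed proof; the
hypothesis is its §6 input and is deliberately not vendored as a fact.
[cite: SchrammSmirnov2011, Lemma 5.1 and eq. (5.1)] -/
theorem SchrammSmirnov2011_lemma_5_1_of_continuity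
    (h : ∀ (D : Set ℂ), IsOpen D → D.Nonempty → ∀ (Q₀ : Quad D) (ε : ℝ≥0∞), 0 < ε →
      ∃ Q' Q'' : Quad D, Quad.StrictlyDominated Q' Q₀ ∧ Quad.StrictlyDominated Q₀ Q'' ∧
        ∃ δ₀ : ℝ, 0 < δ₀ ∧ ∀ δ : ℝ, 0 < δ → δ < δ₀ →
          bondPercolation (zdGraph 2) half
            {ω | (∃ K, Q'.IsCrossing K ∧ K ⊆ openEdgeUnion δ ω) ∧
              ¬ ∃ K, Q''.IsCrossing K ∧ K ⊆ openEdgeUnion δ ω} ≤ ε) :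
    SchrammSmirnov2011_lemma_5_1 :=
  fun D hD hne _ hμ Q₀ =>
    measure_frontier_crossedEvent_eq_zero_of_subseqLimit hD hne hμ Q₀ (h D hD hne Q₀)

end QuadCrossing

end Literature.Probability.Percolation
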